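import Summits.HodgeConjecture.CorCM.Census.CentralSquaresOrbitFrameLaw
import Summits.HodgeConjecture.CorCM.Census.CentralSquaresDihedralFibre

/-!
# The square-central class, XXXIX: the FRAME OF A DIHEDRAL QUOTIENT — base block, swaps, transversals, kernel conjugation, `4`-cycles and their translates

COR-CM (cell `pub-hodgecm2`), count-neutral kernel combinatorics by the binder seat b09 (gen 47; lane SQUARE-CENTRAL CLASS, part XXXIX), the reusable
datum of a surjection `π : G ↠ D₄` with `π c = r²` (part X inlined these facts for one swap; here they are stated for EVERY lift of `s`), plus the
two new ingredients of the kernel-four rows: the conjugation dichotomy in a kernel of order `4` and the `4`-cycles of a lift of `s` of order `4` with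
their kernel translates.  Eight-element facts about `D₄` by `decide`; otherwise theorems only: no definition, no certificate, no named fact, no `sorry`.
HONEST FRAMING: `HC_CM` is NOT proved, here or anywhere in the tree; nothing here is a period or a headline.

THE DATUM.  `T₀ = π⁻¹X₀`, `X₀ = {1, r, s, sr}`; for ANY lift `u` of `s`: `T₀·u⁻¹ = T₁ := π⁻¹(X₀·s)` and `T₁·u⁻¹ = T₀` (`dq_swap`: base-involutive for
free), the place permutation of `u` preserves `𝓗 = T₀ ∖ T₁` (`dq_sigma_H`) and the fibres are transversals of it (`§3`).  `§4` **`dq_ker_conj`**: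
`|ker π| = 4`, `u² ≠ 1 = u⁴` ⟹ every `k ∈ ker π` has `uk = ku` or `uk = ku·u²`.  `§5` **`dq_cycle`**: `(x₀, x₁, x₀u², x₁u²)` is a `4`-cycle of the place
permutation of `u`; **`dq_cycle_translate`**: its translate by `k⁻¹`, `k ∈ ker π`, is again a cycle — forward if `uk = ku`, backward otherwise — so the
translated designated face is the designated face of the translated orbit type (the `hcomp` datum of part XXXVIII, assembled in part XL).

## References
* [Pohlmann1968] H. Pohlmann, Algebraic cycles on abelian varieties of complex multiplication type, Ann. of Math. 88 (1968), Thm 1.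
-/

namespace Summit.HodgeConjecture.CorCM.Census.CentralSquares

open Finset DihedralGroup
open Summit.HodgeConjecture.CorCM.Prior.AllgGroup.RfwfAllgGroup
open Summit.HodgeConjecture.CorCM.Census.BlockParity
open Summit.HodgeConjecture.CorCM.Census.Coinvariant
open Summit.HodgeConjecture.CorCM.Census.TwistGeneration
open Summit.HodgeConjecture.CorCM.Census.BaseBlock

noncomputable section

variable {G : Type*} [Group G] [Fintype G] [DecidableEq G]

/-! ## §1 Eight-element facts about `D₄` -/

/-- The two places of `𝓗` over a fibre pair form a transversal of the swap: for `x ∈ {r, sr}` with swap image `x'`, and `y ∈ {r, sr}`,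
`x = y ↔ x' ≠ y`. [folklore] -/
theorem dihedral_transversal_H : ∀ x x' y : DihedralGroup 4, x ∈ ({r 1, sr 1} : Finset (DihedralGroup 4)) →
    x' ∈ ({r 0, r 1, sr 0, sr 1} : Finset (DihedralGroup 4)) → (x' = x * sr 0 ∨ x' = r 2 * (x * sr 0)) →
    y ∈ ({r 1, sr 1} : Finset (DihedralGroup 4)) → (x = y ↔ x' ≠ y) := by decide

/-- The same inside `T₀ ∩ T₁`: for `x ∈ {1, s}` with swap image `x'`, and `y ∈ {1, s}`, `x = y ↔ x' ≠ y`. [folklore] -/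
theorem dihedral_transversal_Hc : ∀ x x' y : DihedralGroup 4, x ∈ ({r 0, sr 0} : Finset (DihedralGroup 4)) →
    x' ∈ ({r 0, r 1, sr 0, sr 1} : Finset (DihedralGroup 4)) → (x' = x * sr 0 ∨ x' = r 2 * (x * sr 0)) →
    y ∈ ({r 0, sr 0} : Finset (DihedralGroup 4)) → (x = y ↔ x' ≠ y) := by decide

/-- The place permutation of the swap preserves `{1, s}` on `X₀`-representatives. [folklore] -/
theorem dihedral_sigma_Hc : ∀ x y : DihedralGroup 4, x ∈ ({r 0, r 1, sr 0, sr 1} : Finset (DihedralGroup 4)) →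
    y ∈ ({r 0, r 1, sr 0, sr 1} : Finset (DihedralGroup 4)) → (y = x * sr 0 ∨ y = r 2 * (x * sr 0)) →
      (x ∈ ({r 0, sr 0} : Finset (DihedralGroup 4)) ↔ y ∈ ({r 0, sr 0} : Finset (DihedralGroup 4))) := by decide

/-- No element of `D₄` is its own swap image: `x·s ≠ x` and `r²·x·s ≠ x`. [folklore] -/
theorem dihedral_ne_swap : ∀ x : DihedralGroup 4, x * sr 0 ≠ x ∧ r 2 * (x * sr 0) ≠ x ∧ x * sr 0 * sr 0 = x := by decide

section Dihedral

variable {c : G} (hc2 : c * c = 1)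
variable (π : G →* DihedralGroup 4) (hπ : Function.Surjective π) (hπc : π c = r 2)
variable (T₀ : CMF G c) (hT₀ : ∀ P : G, P ∈ T₀.1 ↔ π P ∈ ({r 0, r 1, sr 0, sr 1} : Finset (DihedralGroup 4)))
variable (q : G) (hq : π q = sr 0)

/-! ## §2 The base block and the swaps -/

include hT₀ in
/-- Membership in a base change of `T₀`: `P ∈ T₀·R⁻¹ ↔ π(P)·π(R) ∈ X₀`. [folklore] -/
theorem dq_rt_mem (R P : G) : P ∈ (rt c R T₀).1 ↔ π P * π R ∈ ({r 0, r 1, sr 0, sr 1} : Finset (DihedralGroup 4)) := by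
  rw [mem_rt, hT₀, map_mul]

include hT₀ hq hπc in
/-- **The base block** of `T₀` is `{T₀, T̄₀, T₁, T̄₁}` with `T₁ = T₀·q⁻¹`. [folklore] -/
theorem dq_base : ∀ R : G, rt c R T₀ = T₀ ∨ rt c R T₀ = rt c c T₀ ∨ rt c R T₀ = rt c q T₀ ∨ rt c R T₀ = rt c c (rt c q T₀) := by
  intro R
  have hrr : ∀ P : G, P ∈ (rt c c T₀).1 ↔ π P * r 2 ∈ ({r 0, r 1, sr 0, sr 1} : Finset (DihedralGroup 4)) := fun P => by
    rw [dq_rt_mem π T₀ hT₀, hπc]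
  have hrT₁ : ∀ P : G, P ∈ (rt c c (rt c q T₀)).1 ↔ π P * (r 2 * sr 0) ∈ ({r 0, r 1, sr 0, sr 1} : Finset (DihedralGroup 4)) := fun P => by
    rw [← rt_mul, dq_rt_mem π T₀ hT₀, map_mul, hπc, hq]
  rcases dihedral_base (π R) with h | h | h | h
  · exact Or.inl (Subtype.ext (Finset.ext fun P => by rw [dq_rt_mem π T₀ hT₀, hT₀]; exact h (π P)))
  · exact Or.inr (Or.inl (Subtype.ext (Finset.ext fun P => by rw [dq_rt_mem π T₀ hT₀, hrr]; exact h (π P))))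
  · exact Or.inr (Or.inr (Or.inl (Subtype.ext (Finset.ext fun P => by rw [dq_rt_mem π T₀ hT₀, dq_rt_mem π T₀ hT₀, hq]; exact h (π P)))))
  · exact Or.inr (Or.inr (Or.inr (Subtype.ext (Finset.ext fun P => by rw [dq_rt_mem π T₀ hT₀, hrT₁]; exact h (π P)))))

include hT₀ hπ in
/-- `|T₀| = 4·|ker π|`. [folklore] -/
theorem dq_card : T₀.1.card = 4 * Nat.card π.ker := by
  have e : T₀.1 = univ.filter fun g : G => π g ∈ ({r 0, r 1, sr 0, sr 1} : Finset (DihedralGroup 4)) := by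
    ext P; rw [hT₀, mem_filter]; simp only [mem_univ, true_and]
  rw [e, card_filter_comap π hπ]; congr 1

include hT₀ hq in
/-- `𝓗 = T₀ ∖ T₁ = π⁻¹{r, sr}`. [folklore] -/
theorem dq_Hset : T₀.1 \ (rt c q T₀).1 = univ.filter fun g : G => π g ∈ ({r 1, sr 1} : Finset (DihedralGroup 4)) := by
  ext P; rw [mem_sdiff, hT₀, dq_rt_mem π T₀ hT₀, hq, mem_filter]; simp only [mem_univ, true_and]; exact dihedral_H (π P)

include hT₀ hq in
/-- `T₀ ∩ T₁ = π⁻¹{1, s}`. [folklore] -/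
theorem dq_Hcset : T₀.1 ∩ (rt c q T₀).1 = univ.filter fun g : G => π g ∈ ({r 0, sr 0} : Finset (DihedralGroup 4)) := by
  ext P; rw [mem_inter, hT₀, dq_rt_mem π T₀ hT₀, hq, mem_filter]; simp only [mem_univ, true_and]; exact dihedral_Hc (π P)

include hT₀ hq hπ in
/-- `|𝓗| = 2·|ker π|`. [folklore] -/
theorem dq_card_H : (T₀.1 \ (rt c q T₀).1).card = 2 * Nat.card π.ker := by
  rw [dq_Hset π T₀ hT₀ q hq, card_filter_comap π hπ]; congr 1

include hT₀ hq in
/-- **Every lift of `s` is a base-involutive swap of the same frame**: `T₀·u⁻¹ = T₁` and `T₁·u⁻¹ = T₀`. [folklore] -/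
theorem dq_swap (u : G) (hu : π u = sr 0) : rt c u T₀ = rt c q T₀ ∧ rt c u (rt c q T₀) = T₀ := by
  constructor
  · exact Subtype.ext (Finset.ext fun P => by rw [dq_rt_mem π T₀ hT₀, dq_rt_mem π T₀ hT₀, hu, hq])
  · refine Subtype.ext (Finset.ext fun P => ?_)
    rw [← rt_mul, dq_rt_mem π T₀ hT₀, hT₀, map_mul, hu, hq, show (sr 0 : DihedralGroup 4) * sr 0 = 1 by decide, mul_one]

include hT₀ hq hπc in
/-- **The place permutation of any lift of `s` preserves `𝓗`.** [folklore] -/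
theorem dq_sigma_H (u : G) (hu : π u = sr 0) :
    ∀ t ∈ T₀.1, ∀ t' ∈ T₀.1, (t' = t * u ∨ t' = c * (t * u)) → (t ∈ T₀.1 \ (rt c q T₀).1 ↔ t' ∈ T₀.1 \ (rt c q T₀).1) := by
  intro t ht t' ht' h
  rw [hT₀] at ht ht'
  rw [dq_Hset π T₀ hT₀ q hq, mem_filter, mem_filter]; simp only [mem_univ, true_and]
  refine dihedral_sigma_H (π t) (π t') ht ht' ?_
  rcases h with h | h
  · left; rw [h, map_mul, hu]
  · right; rw [h, map_mul, map_mul, hπc, hu]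

include hT₀ hq hπc in
/-- **The place permutation of any lift of `s` preserves `T₀ ∩ T₁`.** [folklore] -/
theorem dq_sigma_Hc (u : G) (hu : π u = sr 0) :
    ∀ t ∈ T₀.1, ∀ t' ∈ T₀.1, (t' = t * u ∨ t' = c * (t * u)) → (t ∈ T₀.1 ∩ (rt c q T₀).1 ↔ t' ∈ T₀.1 ∩ (rt c q T₀).1) := by
  intro t ht t' ht' h
  rw [hT₀] at ht ht'
  rw [dq_Hcset π T₀ hT₀ q hq, mem_filter, mem_filter]; simp only [mem_univ, true_and]
  refine dihedral_sigma_Hc (π t) (π t') ht ht' ?_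
  rcases h with h | h
  · left; rw [h, map_mul, hu]
  · right; rw [h, map_mul, map_mul, hπc, hu]

/-! ## §3 The fibres as transversals -/

include hT₀ hq hπ hπc in
/-- **A fibre over `r` or `sr` is a transversal of every lift of `s` inside `𝓗`**, of size `|ker π|`. [folklore] -/
theorem dq_transversal_H (u : G) (hu : π u = sr 0) (y : DihedralGroup 4) (hy : y ∈ ({r 1, sr 1} : Finset (DihedralGroup 4))) :
    (univ.filter fun g : G => π g = y) ⊆ T₀.1 \ (rt c q T₀).1 ∧ (univ.filter fun g : G => π g = y).card = Nat.card π.ker ∧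
      ∀ t ∈ T₀.1 \ (rt c q T₀).1, ∀ t' ∈ T₀.1, (t' = t * u ∨ t' = c * (t * u)) →
        (t ∈ (univ.filter fun g : G => π g = y) ↔ t' ∉ (univ.filter fun g : G => π g = y)) := by
  refine ⟨?_, ?_, ?_⟩
  · rw [dq_Hset π T₀ hT₀ q hq]; intro g hg; rw [mem_filter] at hg ⊢; exact ⟨hg.1, by rw [hg.2]; exact hy⟩
  · have h := card_filter_comap π hπ {y}; rw [card_singleton, one_mul] at h; rw [← h]; congr 1; ext g; simp
  · intro t ht t' ht' h
    rw [dq_Hset π T₀ hT₀ q hq, mem_filter] at ht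
    rw [hT₀] at ht'
    rw [mem_filter, mem_filter]; simp only [mem_univ, true_and]
    refine dihedral_transversal_H (π t) (π t') y ht.2 ht' ?_ hy
    rcases h with h | h
    · left; rw [h, map_mul, hu]
    · right; rw [h, map_mul, map_mul, hπc, hu]

include hT₀ hq hπ hπc in
/-- **A fibre over `1` or `s` is a transversal of every lift of `s` inside `T₀ ∩ T₁`**, of size `|ker π|`. [folklore] -/
theorem dq_transversal_Hc (u : G) (hu : π u = sr 0) (y : DihedralGroup 4) (hy : y ∈ ({r 0, sr 0} : Finset (DihedralGroup 4))) :
    (univ.filter fun g : G => π g = y) ⊆ T₀.1 ∩ (rt c q T₀).1 ∧ (univ.filter fun g : G => π g = y).card = Nat.card π.ker ∧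
      ∀ t ∈ T₀.1 ∩ (rt c q T₀).1, ∀ t' ∈ T₀.1, (t' = t * u ∨ t' = c * (t * u)) →
        (t ∈ (univ.filter fun g : G => π g = y) ↔ t' ∉ (univ.filter fun g : G => π g = y)) := by
  refine ⟨?_, ?_, ?_⟩
  · rw [dq_Hcset π T₀ hT₀ q hq]; intro g hg; rw [mem_filter] at hg ⊢; exact ⟨hg.1, by rw [hg.2]; exact hy⟩
  · have h := card_filter_comap π hπ {y}; rw [card_singleton, one_mul] at h; rw [← h]; congr 1; ext g; simp
  · intro t ht t' ht' h
    rw [dq_Hcset π T₀ hT₀ q hq, mem_filter] at ht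
    rw [hT₀] at ht'
    rw [mem_filter, mem_filter]; simp only [mem_univ, true_and]
    refine dihedral_transversal_Hc (π t) (π t') y ht.2 ht' ?_ hy
    rcases h with h | h
    · left; rw [h, map_mul, hu]
    · right; rw [h, map_mul, map_mul, hπc, hu]

/-! ## §4 Conjugation by a lift of order `4` in a kernel of order `4` -/

include hπ in
/-- **KERNEL CONJUGATION DICHOTOMY.**  `|ker π| = 4`, `u` a lift of `s` with `u² ≠ 1`, `u⁴ = 1`: for every `k ∈ ker π`, `uk = ku` or `uk = ku·u²`.
(`u²` and `1` are fixed by conjugation with `u`, which therefore permutes the remaining two kernel elements `{k, ku²}`.) [folklore] -/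
theorem dq_ker_conj (hker : Nat.card π.ker = 4) (u : G) (hu : π u = sr 0) (hz1 : u * u ≠ 1) (hz2 : u * u * (u * u) = 1) :
    ∀ k : G, π k = 1 → (u * k = k * u ∨ u * k = k * u * (u * u)) := by
  intro k hk
  by_cases hk1 : k = 1
  · left; rw [hk1, mul_one, one_mul]
  by_cases hkz : k = u * u
  · left; rw [hkz, ← mul_assoc]
  -- the kernel is `{1, u², k, k·u²}`
  set S := univ.filter fun g : G => π g = 1 with hS
  have hScard : S.card = 4 := by
    have h := card_filter_comap π hπ {1}
    rw [card_singleton, one_mul, hker] at h; rw [← h]; congr 1; ext g; simp [hS]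
  have hmemS : ∀ g : G, g ∈ S ↔ π g = 1 := fun g => by rw [hS, mem_filter]; simp
  have hπz : π (u * u) = 1 := by rw [map_mul, hu]; decide
  have h1S : (1 : G) ∈ S := (hmemS 1).mpr (map_one π)
  have hzS : u * u ∈ S := (hmemS _).mpr hπz
  have hkS : k ∈ S := (hmemS k).mpr hk
  have hkzS : k * (u * u) ∈ S := (hmemS _).mpr (by rw [map_mul, hk, hπz, one_mul])
  have hkz1 : k * (u * u) ≠ 1 := by
    intro h; apply hkz
    have e : k = k * (u * u) * (u * u) := by rw [mul_assoc, hz2, mul_one]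
    rw [h, one_mul] at e; exact e
  have hkzz : k * (u * u) ≠ u * u := by
    intro h; apply hk1
    have e : k * (u * u) = 1 * (u * u) := by rw [h, one_mul]
    exact mul_right_cancel e
  have hkzk : k * (u * u) ≠ k := by
    intro h; apply hz1
    have e : k * (u * u) = k * 1 := by rw [h, mul_one]
    exact mul_left_cancel e
  have hz1' : u * u ≠ 1 := hz1
  have hsub : ({1, u * u, k, k * (u * u)} : Finset G) ⊆ S := by
    intro x hx; simp only [mem_insert, mem_singleton] at hx
    rcases hx with rfl | rfl | rfl | rfl <;> assumption
  have hcard4 : ({1, u * u, k, k * (u * u)} : Finset G).card = 4 := by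
    rw [card_insert_of_notMem, card_insert_of_notMem, card_pair hkzk.symm]
    · rw [mem_insert, mem_singleton, not_or]; exact ⟨Ne.symm hkz, Ne.symm hkzz⟩
    · rw [mem_insert, mem_insert, mem_singleton, not_or, not_or]; exact ⟨hz1'.symm, Ne.symm hk1, Ne.symm hkz1⟩
  have hSeq : S = {1, u * u, k, k * (u * u)} := (eq_of_subset_of_card_le hsub (by rw [hScard, hcard4])).symm
  -- the conjugate `u⁻¹ k u` is a kernel element other than `1` and `u²`
  have hxS : u⁻¹ * k * u ∈ S := (hmemS _).mpr (by rw [map_mul, map_mul, map_inv, hk, mul_one, inv_mul_cancel])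
  have hback : k = u * (u⁻¹ * k * u) * u⁻¹ := by group
  have hx1 : u⁻¹ * k * u ≠ 1 := by
    intro h; apply hk1; rw [hback, h]; group
  have hxz : u⁻¹ * k * u ≠ u * u := by
    intro h; apply hkz; rw [hback, h]; group
  rw [hSeq] at hxS
  simp only [mem_insert, mem_singleton] at hxS
  rcases hxS with h | h | h | h
  · exact absurd h hx1
  · exact absurd h hxz
  · left
    have e : u * (u⁻¹ * k * u) = u * k := by rw [h]
    rw [← mul_assoc, ← mul_assoc, mul_inv_cancel, one_mul] at e
    exact e.symm
  · right
    have e : u * (u⁻¹ * k * u) = u * (k * (u * u)) := by rw [h]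
    rw [← mul_assoc, ← mul_assoc, mul_inv_cancel, one_mul] at e
    -- `e : k * u = u * (k * (u * u))`
    calc u * k = u * k * (u * u * (u * u)) := by rw [hz2, mul_one]
      _ = u * (k * (u * u)) * (u * u) := by simp only [mul_assoc]
      _ = k * u * (u * u) := by rw [← e]

/-! ## §5 Four-cycles of a lift of order `4` and their kernel translates -/

omit [Fintype G] [DecidableEq G] in
/-- **Relations of a cycle are transported by right translation**, the swap being conjugated: if `b = a·u` or `c·(a·u)` then
`b·k⁻¹ = (a·k⁻¹)·(kuk⁻¹)` or `c·((a·k⁻¹)·(kuk⁻¹))`. [folklore] -/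
theorem rel_translate (u k : G) {a b : G} (h : b = a * u ∨ b = c * (a * u)) :
    b * k⁻¹ = a * k⁻¹ * (k * u * k⁻¹) ∨ b * k⁻¹ = c * (a * k⁻¹ * (k * u * k⁻¹)) := by
  have e : a * k⁻¹ * (k * u * k⁻¹) = a * u * k⁻¹ := by group
  rw [e]
  rcases h with h | h
  · left; rw [h]
  · right; rw [h, mul_assoc]

omit [Fintype G] [DecidableEq G] in
include hc2 in
/-- **A cycle of `u³` is a cycle of `u` read backwards** (`u⁴ = 1`): from the relations of `(y₀, y₁, y₂, y₃)` for the swap `u·u²` follow the relations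
of `(y₁, y₀, y₃, y₂)` for `u`. [folklore] -/
theorem cycle_reverse (u : G) (hz2 : u * u * (u * u) = 1) {y₀ y₁ y₂ y₃ : G}
    (s₀ : y₁ = y₀ * (u * (u * u)) ∨ y₁ = c * (y₀ * (u * (u * u)))) (s₁ : y₂ = y₁ * (u * (u * u)) ∨ y₂ = c * (y₁ * (u * (u * u))))
    (s₂ : y₃ = y₂ * (u * (u * u)) ∨ y₃ = c * (y₂ * (u * (u * u)))) (s₃ : y₀ = y₃ * (u * (u * u)) ∨ y₀ = c * (y₃ * (u * (u * u)))) :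
    (y₀ = y₁ * u ∨ y₀ = c * (y₁ * u)) ∧ (y₃ = y₀ * u ∨ y₃ = c * (y₀ * u)) ∧ (y₂ = y₃ * u ∨ y₂ = c * (y₃ * u)) ∧
      (y₁ = y₂ * u ∨ y₁ = c * (y₂ * u)) := by
  have hv : ∀ y : G, y * (u * (u * u)) * u = y := fun y => by
    rw [show y * (u * (u * u)) * u = y * (u * u * (u * u)) by simp only [mul_assoc], hz2, mul_one]
  have back : ∀ a b : G, (b = a * (u * (u * u)) ∨ b = c * (a * (u * (u * u)))) → (a = b * u ∨ a = c * (b * u)) := by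
    intro a b h
    rcases h with h | h
    · left; rw [h, hv]
    · right; rw [h, mul_assoc c, hv, cmul_cmul c hc2]
  exact ⟨back _ _ s₀, back _ _ s₃, back _ _ s₂, back _ _ s₁⟩

include hc2 hT₀ hq hπc in
/-- **THE `4`-CYCLE OF A LIFT OF ORDER `4`.**  `u` a lift of `s` with `u² ≠ 1 = u⁴`; `x₀ ∈ T₀` and the representative `x₁ ∈ T₀` of the place of
`x₀·u`.  Then `(x₀, x₁, x₀u², x₁u²)` is a `4`-cycle of the place permutation of `u` (all in `T₀`, the four relations, pairwise distinct), inside `𝓗`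
if `x₀ ∈ 𝓗` and inside `T₀ ∩ T₁` if `x₀ ∈ T₀ ∩ T₁`. [folklore] -/
theorem dq_cycle (u : G) (hu : π u = sr 0) (hz1 : u * u ≠ 1) (hz2 : u * u * (u * u) = 1)
    {x₀ x₁ : G} (hx₀ : x₀ ∈ T₀.1) (hx₁ : x₁ ∈ T₀.1) (r₀ : x₁ = x₀ * u ∨ x₁ = c * (x₀ * u)) :
    x₀ * (u * u) ∈ T₀.1 ∧ x₁ * (u * u) ∈ T₀.1 ∧
    (x₀ * (u * u) = x₁ * u ∨ x₀ * (u * u) = c * (x₁ * u)) ∧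
    (x₁ * (u * u) = x₀ * (u * u) * u ∨ x₁ * (u * u) = c * (x₀ * (u * u) * u)) ∧
    (x₀ = x₁ * (u * u) * u ∨ x₀ = c * (x₁ * (u * u) * u)) ∧
    (x₀ ≠ x₁ ∧ x₁ ≠ x₀ * (u * u) ∧ x₀ * (u * u) ≠ x₁ * (u * u) ∧ x₁ * (u * u) ≠ x₀ ∧ x₀ ≠ x₀ * (u * u) ∧ x₁ ≠ x₁ * (u * u)) ∧
    (x₀ ∈ T₀.1 \ (rt c q T₀).1 →
      x₁ ∈ T₀.1 \ (rt c q T₀).1 ∧ x₀ * (u * u) ∈ T₀.1 \ (rt c q T₀).1 ∧ x₁ * (u * u) ∈ T₀.1 \ (rt c q T₀).1) ∧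
    (x₀ ∈ T₀.1 ∩ (rt c q T₀).1 →
      x₁ ∈ T₀.1 ∩ (rt c q T₀).1 ∧ x₀ * (u * u) ∈ T₀.1 ∩ (rt c q T₀).1 ∧ x₁ * (u * u) ∈ T₀.1 ∩ (rt c q T₀).1) := by
  have hπz : π (u * u) = 1 := by rw [map_mul, hu]; decide
  have hz2' : u * (u * (u * u)) = 1 := by simpa only [mul_assoc] using hz2
  have hzT₀ : ∀ x : G, x ∈ T₀.1 → x * (u * u) ∈ T₀.1 := fun x hx => by rw [hT₀, map_mul, hπz, mul_one]; exact (hT₀ x).mp hx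
  have hπx₁ : π x₁ = π x₀ * sr 0 ∨ π x₁ = r 2 * (π x₀ * sr 0) := by
    rcases r₀ with h | h
    · left; rw [h, map_mul, hu]
    · right; rw [h, map_mul, map_mul, hπc, hu]
  have hne : π x₁ ≠ π x₀ := by
    rcases hπx₁ with e | e <;> rw [e]
    · exact (dihedral_ne_swap (π x₀)).1
    · exact (dihedral_ne_swap (π x₀)).2.1
  refine ⟨hzT₀ x₀ hx₀, hzT₀ x₁ hx₁, ?_, ?_, ?_, ⟨?_, ?_, ?_, ?_, ?_, ?_⟩, ?_, ?_⟩
  · rcases r₀ with h | h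
    · left; rw [h, mul_assoc]
    · right; rw [h]; simp only [mul_assoc, cmul_cmul c hc2]
  · rcases r₀ with h | h
    · left; simp only [h, mul_assoc]
    · right; simp only [h, mul_assoc]
  · rcases r₀ with h | h
    · left; rw [h]; simp only [mul_assoc, hz2', mul_one]
    · right; rw [h]; simp only [mul_assoc, hz2', mul_one, cmul_cmul c hc2]
  · intro h; exact hne (by rw [h])
  · intro h; exact hne (by rw [h, map_mul, hπz, mul_one])
  · intro h; exact hne (by rw [(mul_right_cancel h : x₀ = x₁)])
  · intro h; exact hne (by rw [← h, map_mul, hπz, mul_one])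
  · intro h; exact hz1 (mul_left_cancel (h.symm.trans (mul_one x₀).symm).symm).symm
  · intro h; exact hz1 (mul_left_cancel (h.symm.trans (mul_one x₁).symm).symm).symm
  · intro h₀
    have h₁ := (dq_sigma_H π hπc T₀ hT₀ q hq u hu x₀ hx₀ x₁ hx₁ r₀).mp h₀
    rw [dq_Hset π T₀ hT₀ q hq] at h₀ h₁ ⊢
    rw [mem_filter] at h₀ h₁
    refine ⟨mem_filter.mpr h₁, mem_filter.mpr ⟨mem_univ _, ?_⟩, mem_filter.mpr ⟨mem_univ _, ?_⟩⟩
    · rw [map_mul, hπz, mul_one]; exact h₀.2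
    · rw [map_mul, hπz, mul_one]; exact h₁.2
  · intro h₀
    have h₁ := (dq_sigma_Hc π hπc T₀ hT₀ q hq u hu x₀ hx₀ x₁ hx₁ r₀).mp h₀
    rw [dq_Hcset π T₀ hT₀ q hq] at h₀ h₁ ⊢
    rw [mem_filter] at h₀ h₁
    refine ⟨mem_filter.mpr h₁, mem_filter.mpr ⟨mem_univ _, ?_⟩, mem_filter.mpr ⟨mem_univ _, ?_⟩⟩
    · rw [map_mul, hπz, mul_one]; exact h₀.2
    · rw [map_mul, hπz, mul_one]; exact h₁.2

include hπ in
/-- **KERNEL TRANSLATES OF A `4`-CYCLE.**  `|ker π| = 4`, `u` a lift of `s` with `u² ≠ 1 = u⁴`, a `4`-cycle `(x₀, x₁, x₂, x₃)` of `u` (the four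
relations), `k ∈ ker π`.  Then EITHER `uk = ku` and `(x₀k⁻¹, x₁k⁻¹, x₂k⁻¹, x₃k⁻¹)` satisfies the four relations for `u`, OR `uk = ku·u²` and
`(x₁k⁻¹, x₀k⁻¹, x₃k⁻¹, x₂k⁻¹)` does. [folklore] -/
theorem dq_cycle_translate (hc2 : c * c = 1) (hker : Nat.card π.ker = 4) (u : G) (hu : π u = sr 0) (hz1 : u * u ≠ 1)
    (hz2 : u * u * (u * u) = 1) {x₀ x₁ x₂ x₃ : G}
    (r₀ : x₁ = x₀ * u ∨ x₁ = c * (x₀ * u)) (r₁ : x₂ = x₁ * u ∨ x₂ = c * (x₁ * u)) (r₂ : x₃ = x₂ * u ∨ x₃ = c * (x₂ * u))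
    (r₃ : x₀ = x₃ * u ∨ x₀ = c * (x₃ * u)) (k : G) (hk : π k = 1) :
    (u * k = k * u ∧
      (x₁ * k⁻¹ = x₀ * k⁻¹ * u ∨ x₁ * k⁻¹ = c * (x₀ * k⁻¹ * u)) ∧ (x₂ * k⁻¹ = x₁ * k⁻¹ * u ∨ x₂ * k⁻¹ = c * (x₁ * k⁻¹ * u)) ∧
      (x₃ * k⁻¹ = x₂ * k⁻¹ * u ∨ x₃ * k⁻¹ = c * (x₂ * k⁻¹ * u)) ∧ (x₀ * k⁻¹ = x₃ * k⁻¹ * u ∨ x₀ * k⁻¹ = c * (x₃ * k⁻¹ * u))) ∨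
    (u * k = k * u * (u * u) ∧
      (x₀ * k⁻¹ = x₁ * k⁻¹ * u ∨ x₀ * k⁻¹ = c * (x₁ * k⁻¹ * u)) ∧ (x₃ * k⁻¹ = x₀ * k⁻¹ * u ∨ x₃ * k⁻¹ = c * (x₀ * k⁻¹ * u)) ∧
      (x₂ * k⁻¹ = x₃ * k⁻¹ * u ∨ x₂ * k⁻¹ = c * (x₃ * k⁻¹ * u)) ∧ (x₁ * k⁻¹ = x₂ * k⁻¹ * u ∨ x₁ * k⁻¹ = c * (x₂ * k⁻¹ * u))) := by
  have t₀ := rel_translate (c := c) u k r₀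
  have t₁ := rel_translate (c := c) u k r₁
  have t₂ := rel_translate (c := c) u k r₂
  have t₃ := rel_translate (c := c) u k r₃
  rcases dq_ker_conj π hπ hker u hu hz1 hz2 k hk with h | h
  · left
    have hw : k * u * k⁻¹ = u := by rw [← h, mul_assoc, mul_inv_cancel, mul_one]
    rw [hw] at t₀ t₁ t₂ t₃
    exact ⟨h, t₀, t₁, t₂, t₃⟩
  · right
    -- `u²` commutes with `k`, and `kuk⁻¹ = u·u²`
    have hzk : u * u * k = k * (u * u) := by
      calc u * u * k = u * (u * k) := by rw [mul_assoc]
        _ = u * (k * u * (u * u)) := by rw [h]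
        _ = (u * k) * (u * (u * u)) := by simp only [mul_assoc]
        _ = (k * u * (u * u)) * (u * (u * u)) := by rw [h]
        _ = k * (u * (u * u * (u * u)) * u) := by simp only [mul_assoc]
        _ = k * (u * u) := by rw [hz2, mul_one]
    have e1 : k * u = u * k * (u * u) := by
      calc k * u = k * u * (u * u * (u * u)) := by rw [hz2, mul_one]
        _ = (k * u * (u * u)) * (u * u) := by simp only [mul_assoc]
        _ = u * k * (u * u) := by rw [← h]
    have e2 : k⁻¹ * (u * u) = (u * u) * k⁻¹ := by
      calc k⁻¹ * (u * u) = k⁻¹ * (u * u * k) * k⁻¹ := by group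
        _ = k⁻¹ * (k * (u * u)) * k⁻¹ := by rw [hzk]
        _ = (u * u) * k⁻¹ := by group
    have hw : k * u * k⁻¹ = u * (u * u) := by
      calc k * u * k⁻¹ = u * k * (u * u) * k⁻¹ := by rw [e1]
        _ = u * k * ((u * u) * k⁻¹) := by simp only [mul_assoc]
        _ = u * k * (k⁻¹ * (u * u)) := by rw [e2]
        _ = u * (u * u) := by group
    rw [hw] at t₀ t₁ t₂ t₃
    exact ⟨h, cycle_reverse hc2 u hz2 t₀ t₁ t₂ t₃⟩

end Dihedral

end

end Summit.HodgeConjecture.CorCM.Census.CentralSquares
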